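import Mathlib.RingTheory.PowerSeries.Substitution
import Mathlib.RingTheory.PowerSeries.Expand
import Mathlib.RingTheory.PowerSeries.Derivative
import Mathlib.RingTheory.PowerSeries.Trunc
import Mathlib.RingTheory.PowerSeries.Order
import Mathlib.RingTheory.PowerSeries.NoZeroDivisors
import Mathlib.Algebra.Polynomial.Taylor
import Mathlib.Algebra.CharP.Frobenius
import Mathlib.Algebra.CharP.Quotient
import Mathlib.RingTheory.Ideal.Quotient.Basic
import Mathlib.NumberTheory.Padics.RingHoms
import Mathlib.RingTheory.WittVector.Identities
import Mathlib.RingTheory.WittVector.Domain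
import Mathlib.FieldTheory.Perfect
import Literature.NumberTheory.EllipticCurves.DivisionPolynomialFormalMulProofs
import Literature.NumberTheory.EllipticCurves.FormalGroupHasseInvariantProofs
import Literature.RingTheory.FormalGroups.FunctionalEquationIntegrality
import Literature.NumberTheory.EllipticCurves.FormalGroupMultiplicationUniversalProofs
import Literature.NumberTheory.EllipticCurves.FormalGroupLogHomProofs
import Literature.RingTheory.FormalGroups.HondaTypeTransport
import Literature.NumberTheory.EllipticCurves.FormalMulTwoSecondCoeffProofs
import Mathlib.RingTheory.WittVector.FrobeniusFractionField
import Mathlib.RingTheory.WittVector.Compare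
import Mathlib.FieldTheory.Finite.Basic
import Literature.NumberTheory.EllipticCurves.FormalLogExpBaseChangeProofs
import Summits.BirchSwinnertonDyer.BirchSwinnertonDyer.Theorems.EisensteinDepletionAtTwoStarGO2KEtaTheoremKWittA
import HarnessLib

/-!
# THEOREM K (the 2-adic Kummer class law for `z²(x(z) − x₀)`), kernel formalisation — KEtaTheoremKWittB
(crux `StarGO2Sigma`, stmt-BirchSwinnertonDyer-27046; line kummer, research stub `stub_discrepancyCover`)

Planner bsd-rank2-p2 GEN 36–37's K-UNIV / K-ETA kernel files (HOME/p2/g37/lean, memo K-UNIV.md; monolith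
`KummerTheoremK_full.lean`, lean rc 0, 0 sorries), landed by the lead star-p1 GEN 12 in ≤ 400-line parts, verbatim except for
file packaging.  This part: THEOREM K EXPLICIT — the `F₀`-free Kummer class law `theoremK_explicit` (∃ s̄, s̄ − s̄² = Λ̄, δ̄(g∘z) = (ḡ∘z̄)²(s̄∘z̄ + (ω̄∘z̄)²d̄_z)) and the instance-free packaging.
Nothing here reads `r_an`; `StarGO2Sigma` / E1M / BSD are NOT proved by this file.
-/

set_option linter.dupNamespace false
set_option linter.unusedSectionVars false
set_option autoImplicit false

noncomputable section

/-! ## THEOREM K EXPLICIT — the `F₀`-free Kummer class law `D(g∘z) = S(λ̄)∘z̄ + (ω̄∘z̄)²·d̄_z` -/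

namespace Summit.BirchSwinnertonDyer.BirchSwinnertonDyer.Theorems.DepletionAtTwo.KEta.TheoremKWitt

open PowerSeries Literature.RingTheory.FormalGroups

variable (k : Type*) [Field k] [IsAlgClosed k] [CharP k 2]

/-- `Λ̄ ∈ k⟦X⟧`: the reduction of the integral `λ`-series `Λ = log_W − (α/2)log_W(X²) ∈ ℤ₂⟦X⟧`
(`WittExistence.lamInt`), pushed along `ℤ₂ → 𝕎(k) → k`. [K-UNIV.md §2.9] -/
def lamBar (W : WeierstrassCurve ℤ) (a : ℤ) {α : ℤ_[2]} (hαn : ‖α‖ = 1)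
    (hroot : (α : ℚ_[2]) ^ 2 - a * α + 2 = 0)
    (hH : ∀ n, ‖coeff n (hondaShift 2 (a : ℚ_[2]) (W.map (Int.castRingHom ℚ_[2])).formalLog)‖ ≤ 1) :
    PowerSeries k :=
  PowerSeries.map ((WittVector.constantCoeff : WittVector 2 k →+* k).comp (WittExistence.iota k))
    (WittExistence.lamInt W a hαn hroot hH)

variable [Algebra ℚ (FractionRing (WittVector 2 k))]

/-- **The Artin–Schreier class of the comparison function.** There is `s ∈ 𝕎(k)⟦X⟧` with
`φ(F₀) = F₀²(1 + 2s)` (so `δ(F₀) = F₀²·s` is a Dwork witness of `F₀`), `s(0) = 0` and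
`s̄ − s̄² = Λ̄` in `k⟦X⟧`. (GEN 36 Lemma 2 `ExpClass.frob_exp_class` over `(Frac 𝕎(k), 𝕎(k), σ)`
with defect `w = c₀·j_*λ` from `coeff_defect_eq`, descended along `𝕎(k) ↪ Frac 𝕎(k)`.)
[K-UNIV.md §2.8, K-ETA.md §4 Lemma 2] -/
theorem exists_artinSchreier_witness (W : WeierstrassCurve ℤ) (a : ℤ) {α : ℤ_[2]} (hαn : ‖α‖ = 1)
    (hroot : (α : ℚ_[2]) ^ 2 - a * α + 2 = 0)
    (hH : ∀ n, ‖coeff n (hondaShift 2 (a : ℚ_[2]) (W.map (Int.castRingHom ℚ_[2])).formalLog)‖ ≤ 1) :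
    ∃ s : PowerSeries (WittVector 2 k),
      Kernel.phi (WittVector.frobenius : WittVector 2 k →+* WittVector 2 k) (compFn k W a hαn hroot hH) =
          compFn k W a hαn hroot hH ^ 2 + 2 * (compFn k W a hαn hroot hH ^ 2 * s) ∧
        constantCoeff s = 0 ∧
        PowerSeries.map (WittVector.constantCoeff : WittVector 2 k →+* k) s -
            PowerSeries.map (WittVector.constantCoeff : WittVector 2 k →+* k) s ^ 2 =
          lamBar k W a hαn hroot hH := by
  obtain ⟨h2r, hker, hfrob⟩ := Kernel.frobeniusLift_wittVector k
  have hαu : IsUnit α := PadicInt.isUnit_iff.mpr hαn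
  -- notation-free abbreviations
  set ιK := algebraMap (WittVector 2 k) (FractionRing (WittVector 2 k)) with hιK
  have hιKi : Function.Injective ιK := IsFractionRing.injective _ _
  set σK := WittExistence.fracFrobenius k with hσK
  set c₀ := WittExistence.period (k := k) hαu with hc₀
  set F₀ := compFn k W a hαn hroot hH with hF₀
  set Λ := WittExistence.lamInt W a hαn hroot hH with hΛ
  set aK : PowerSeries (FractionRing (WittVector 2 k)) :=
    C (ιK c₀) * (W.map (Int.castRingHom (FractionRing (WittVector 2 k)))).formalLog with haK
  set w : PowerSeries (FractionRing (WittVector 2 k)) :=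
    aK - (2 : ℚ)⁻¹ • expand 2 two_ne_zero (PowerSeries.map σK aK) with hw
  have hc : WittVector.constantCoeff c₀ = 1 := by
    rw [WittVector.constantCoeff_apply]; exact WittExistence.coeff_zero_period _
  have ha0 : constantCoeff aK = 0 := by
    rw [haK, map_mul, WeierstrassCurve.constantCoeff_formalLog, mul_zero]
  have hw_coeff : ∀ n, coeff n w = ιK (c₀ * WittExistence.iota k (coeff n Λ)) := fun n =>
    WittExistence.coeff_defect_eq k W a hαn hroot hH n
  have hwO : w = PowerSeries.map ιK (C c₀ * PowerSeries.map (WittExistence.iota k) Λ) := by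
    ext n; rw [hw_coeff, coeff_map, coeff_C_mul, coeff_map]
  have hw0 : constantCoeff w = 0 := by
    rw [← coeff_zero_eq_constantCoeff_apply, hw_coeff, coeff_zero_eq_constantCoeff_apply,
      WittExistence.constantCoeff_lamInt, map_zero, mul_zero, map_zero]
  have hwA : ∀ n, coeff n w ∈ WittExistence.intRange k := fun n => by
    rw [hw_coeff]; exact WittExistence.algebraMap_mem_intRange k _
  have hy : expand 2 two_ne_zero (aK.map σK) = 2 * aK - 2 * w :=
    ExpClass.expand_map_eq_of_sub_smul σK aK
  obtain ⟨s, hsA, hE, hcl⟩ := ExpClass.frob_exp_class (WittExistence.intRange k) σK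
    (WittExistence.hA k) ha0 hw0 hwA hy
  -- descend `s`
  choose sc hsc using fun n => (WittExistence.mem_intRange_iff k).mp (hsA n)
  set sO : PowerSeries (WittVector 2 k) := PowerSeries.mk sc with hsO
  have hsOK : PowerSeries.map ιK sO = s := by ext n; rw [coeff_map, hsO, coeff_mk, hsc]
  have hFK : PowerSeries.map ιK F₀ = (exp (FractionRing (WittVector 2 k))).subst aK :=
    map_compFn k W a hαn hroot hH
  have hcomp : ιK.comp (WittVector.frobenius : WittVector 2 k →+* WittVector 2 k) = σK.comp ιK := by
    ext x; exact (WittExistence.fracFrobenius_algebraMap k x).symm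
  have hδF : Kernel.phi (WittVector.frobenius : WittVector 2 k →+* WittVector 2 k) F₀ =
      F₀ ^ 2 + 2 * (F₀ ^ 2 * sO) := by
    apply PowerSeries.map_injective ιK hιKi
    rw [Kernel.phi_def, map_expand, Kernel.map_map_apply', hcomp, ← Kernel.map_map_apply', hFK,
      hE, map_add, map_mul, map_mul, map_pow, map_ofNat, hFK, hsOK]
    ring
  refine ⟨sO, hδF, ?_, ?_⟩
  · -- `s(0) = 0`: constant terms of `φ(F₀) = F₀²(1 + 2s)`, `F₀(0) = 1`
    have hF0 : constantCoeff F₀ = 1 :=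
      ExpSide.constantCoeff_eq_one_of_map ιK hιKi _ (map_compFn_eq_expLog k W a hαn hroot hH)
    have h := congrArg constantCoeff hδF
    rw [Kernel.constantCoeff_phi, map_add, map_mul, map_mul, map_pow, hF0, map_one, one_pow, one_mul,
      map_ofNat, left_eq_add] at h
    exact h2r _ h
  · -- `s̄ − s̄² = Λ̄`
    have h2k : (2 : k) = 0 := by
      have h := CharP.cast_eq_zero k 2
      simpa using h
    ext n
    obtain ⟨b, hb, hbn⟩ := hcl n
    obtain ⟨bO, rfl⟩ := (WittExistence.mem_intRange_iff k).mp hb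
    have hn : coeff n (sO - sO ^ 2 - C c₀ * PowerSeries.map (WittExistence.iota k) Λ) = 2 * bO := by
      apply hιKi
      rw [← coeff_map, map_sub (PowerSeries.map ιK), map_sub (PowerSeries.map ιK),
        map_pow (PowerSeries.map ιK), ← hwO, hsOK, hbn, map_mul ιK, map_ofNat ιK]
    have hπ : (WittVector.constantCoeff : WittVector 2 k →+* k)
        (coeff n (sO - sO ^ 2 - C c₀ * PowerSeries.map (WittExistence.iota k) Λ)) = 0 := by
      rw [hn, map_mul, map_ofNat, h2k, zero_mul]
    rw [← coeff_map, map_sub (PowerSeries.map (WittVector.constantCoeff : WittVector 2 k →+* k)),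
      map_sub (PowerSeries.map (WittVector.constantCoeff : WittVector 2 k →+* k)),
      map_pow (PowerSeries.map (WittVector.constantCoeff : WittVector 2 k →+* k)),
      map_mul (PowerSeries.map (WittVector.constantCoeff : WittVector 2 k →+* k)), map_C, hc, map_one,
      one_mul, Kernel.map_map_apply',
      map_sub (coeff n) (PowerSeries.map (WittVector.constantCoeff : WittVector 2 k →+* k) sO -
        PowerSeries.map (WittVector.constantCoeff : WittVector 2 k →+* k) sO ^ 2), sub_eq_zero] at hπ
    rw [hπ, lamBar]

/-- `[2](z) = 2z − a₁z² + ⋯` (tree `coeff_two_formalMul_two`): if `π(a₁) = 1` then `π_*[2] ≠ 0`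
(its `z²`-coefficient is `−1`).  Discharges the `h2` hypothesis of `theoremK_witt` from `ha1`. -/
theorem map_formalMul_two_ne_zero {O S : Type*} [CommRing O] [CommRing S] [Nontrivial S]
    (π : O →+* S) (W : WeierstrassCurve O) (ha1 : π W.a₁ = 1) :
    PowerSeries.map π (W.formalMul 2) ≠ 0 := by
  intro h
  have h2 := congrArg (coeff 2) h
  rw [coeff_map, WeierstrassCurve.coeff_two_formalMul_two, map_neg, ha1, map_zero] at h2
  exact one_ne_zero (neg_eq_zero.mp h2)

/-- An INTEGRAL `2`-torsion `x`-coordinate reduces to `ā₃` when `ā₁ = 1`: mod `2` the `2`-division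
cubic `4x³ + b₂x² + 2b₄x + b₆` is `(ā₁x + ā₃)²`.  Discharges `hx0` of `theoremK_witt`. -/
theorem constantCoeff_eq_of_twoTorsionX {O S : Type*} [CommRing O] [CommRing S] [IsReduced S]
    [CharP S 2] (π : O →+* S) (W : WeierstrassCurve O) {x₀ : O}
    (hx : 4 * x₀ ^ 3 + W.b₂ * x₀ ^ 2 + 2 * W.b₄ * x₀ + W.b₆ = 0) (ha1 : π W.a₁ = 1) :
    π x₀ = π W.a₃ := by
  have h2 : (2 : S) = 0 := by simpa using CharP.cast_eq_zero S 2
  have h := congrArg π hx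
  simp only [WeierstrassCurve.b₂, WeierstrassCurve.b₄, WeierstrassCurve.b₆, map_add, map_mul, map_pow,
    map_ofNat, map_zero, ha1] at h
  have hsq : (π x₀ + π W.a₃) ^ 2 = 0 := by
    linear_combination h - (2 * π x₀ ^ 3 + 2 * π W.a₂ * π x₀ ^ 2 + 2 * π W.a₄ * π x₀ +
      2 * π W.a₆) * h2
  have h0 : π x₀ + π W.a₃ = 0 := pow_eq_zero_iff (n := 2) two_ne_zero |>.mp hsq
  have hneg : -π W.a₃ = π W.a₃ := by
    rw [neg_eq_iff_add_eq_zero, ← two_mul, h2, zero_mul]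
  rw [← hneg]; exact eq_neg_of_add_eq_zero_left h0

/-- **THEOREM K, EXPLICIT FORM (K-UNIV.md §2.10 / K-ETA.md (★η)).** Same curve-side hypotheses as
`theoremK_witt`, reduced to the minimum: Honda type `hH` + unit root `α` + an INTEGRAL `2`-torsion `x`-coordinate `x₀ ∈ 𝕎(k)` + `ā₁ = 1`
(`h2`, `hx0`, `B` of `theoremK_witt` are derived: `map_formalMul_two_ne_zero`, `constantCoeff_eq_of_twoTorsionX`, `exists_half`).  There is `s̄ ∈ k⟦X⟧` with `s̄(0) = 0` and `s̄ − s̄² = Λ̄` (the Artin–Schreier class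
`S(λ̄)`) such that for EVERY `z ∈ X𝕎(k)⟦X⟧` with Dwork witness `d_z` (`φz = z² + 2d_z`) and every
Dwork witness `δ` of `g∘z`, `g = X²(x(X) − x₀)`:
`δ̄ = (ḡ∘z̄)² · ( s̄∘z̄ + (ω̄∘z̄)²·d̄_z )` in `k⟦X⟧`, `ω = formalInvDiff`.
The comparison function `F₀` has disappeared: the `2`-adic Kummer class of `z²(x(z) − x₀)` is the
explicit unit-square datum `S(λ̄)∘z̄ + (ω̄∘z̄)²·d̄_z`. -/
theorem theoremK_explicit (W : WeierstrassCurve ℤ) (a : ℤ) {α : ℤ_[2]} (hαn : ‖α‖ = 1)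
    (hroot : (α : ℚ_[2]) ^ 2 - a * α + 2 = 0)
    (hH : ∀ n, ‖coeff n (hondaShift 2 (a : ℚ_[2]) (W.map (Int.castRingHom ℚ_[2])).formalLog)‖ ≤ 1)
    {x₀ : WittVector 2 k}
    (hx : 4 * x₀ ^ 3 + (W.map (Int.castRingHom (WittVector 2 k))).b₂ * x₀ ^ 2 +
      2 * (W.map (Int.castRingHom (WittVector 2 k))).b₄ * x₀ +
        (W.map (Int.castRingHom (WittVector 2 k))).b₆ = 0)
    (ha1 : WittVector.constantCoeff (W.map (Int.castRingHom (WittVector 2 k))).a₁ = 1) :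
    ∃ sbar : PowerSeries k, constantCoeff sbar = 0 ∧ sbar - sbar ^ 2 = lamBar k W a hαn hroot hH ∧
      ∀ (z dz δgz : PowerSeries (WittVector 2 k)), constantCoeff z = 0 →
        Kernel.phi (WittVector.frobenius : WittVector 2 k →+* WittVector 2 k) z = z ^ 2 + 2 * dz →
        Kernel.phi (WittVector.frobenius : WittVector 2 k →+* WittVector 2 k)
            (((W.map (Int.castRingHom (WittVector 2 k))).formalXMulSq - C x₀ * X ^ 2).subst z) =
          (((W.map (Int.castRingHom (WittVector 2 k))).formalXMulSq - C x₀ * X ^ 2).subst z) ^ 2 +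
            2 * δgz →
        PowerSeries.map (WittVector.constantCoeff : WittVector 2 k →+* k) δgz =
          (PowerSeries.map (WittVector.constantCoeff : WittVector 2 k →+* k)
              (((W.map (Int.castRingHom (WittVector 2 k))).formalXMulSq - C x₀ * X ^ 2).subst z)) ^ 2 *
            (sbar.subst (PowerSeries.map (WittVector.constantCoeff : WittVector 2 k →+* k) z) +
              ((PowerSeries.map (WittVector.constantCoeff : WittVector 2 k →+* k)
                  (W.map (Int.castRingHom (WittVector 2 k))).formalInvDiff).subst
                (PowerSeries.map (WittVector.constantCoeff : WittVector 2 k →+* k) z)) ^ 2 *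
              PowerSeries.map (WittVector.constantCoeff : WittVector 2 k →+* k) dz) := by
  obtain ⟨h2r, hker, hfrob⟩ := Kernel.frobeniusLift_wittVector k
  have hαu : IsUnit α := PadicInt.isUnit_iff.mpr hαn
  obtain ⟨sO, hδF, hs0, hAS⟩ := exists_artinSchreier_witness k W a hαn hroot hH
  have h2 := map_formalMul_two_ne_zero (WittVector.constantCoeff : WittVector 2 k →+* k)
    (W.map (Int.castRingHom (WittVector 2 k))) ha1
  have hx0 := constantCoeff_eq_of_twoTorsionX (WittVector.constantCoeff : WittVector 2 k →+* k)
    (W.map (Int.castRingHom (WittVector 2 k))) hx ha1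
  obtain ⟨B, hB⟩ := exists_half hker (W.map (Int.castRingHom (WittVector 2 k))) ha1 hx0
  set π : WittVector 2 k →+* k := WittVector.constantCoeff with hπdef
  set F₀ := compFn k W a hαn hroot hH with hF₀
  set WO := W.map (Int.castRingHom (WittVector 2 k)) with hWO
  have hc : π (WittExistence.period (k := k) hαu) = 1 := by
    rw [hπdef, WittVector.constantCoeff_apply]; exact WittExistence.coeff_zero_period _
  refine ⟨PowerSeries.map π sO, ?_, hAS, ?_⟩
  · rw [← coeff_zero_eq_constantCoeff_apply, coeff_map, coeff_zero_eq_constantCoeff_apply, hs0, map_zero]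
  intro z dz δgz hz0 hzφ hgz
  obtain ⟨δFz, hFz⟩ := Kernel.exists_delta hker hfrob (F₀.subst z)
  have TK := theoremK_witt k W a hαn hroot hH hx hB ha1 hx0 h2 hz0 hgz hFz
  have CR := Kernel.chainRule h2r hker hfrob hz0 hδF hzφ hFz
  -- reduce the chain-rule right-hand side
  have hzb0 : constantCoeff (PowerSeries.map π z) = 0 := by
    rw [← coeff_zero_eq_constantCoeff_apply, coeff_map, coeff_zero_eq_constantCoeff_apply, hz0, map_zero]
  have hzs : HasSubst (PowerSeries.map π z) := HasSubst.of_constantCoeff_zero' hzb0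
  have hzs' : HasSubst z := HasSubst.of_constantCoeff_zero' hz0
  have hdF : d⁄dX k (PowerSeries.map π F₀) = PowerSeries.map π WO.formalInvDiff * PowerSeries.map π F₀ := by
    rw [Kernel.derivative_map', hF₀, derivative_compFn, map_mul, map_mul, map_C, hc, map_one, one_mul]
  have hFz' : PowerSeries.map π (F₀.subst z) = (PowerSeries.map π F₀).subst (PowerSeries.map π z) :=
    Kernel.map_subst_apply' hzs' π F₀
  rw [hdF, map_mul, map_pow, subst_mul hzs, subst_mul hzs, subst_pow hzs, ← hFz'] at CR
  -- cancel `(F̄₀∘z̄)²`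
  have hFzne : PowerSeries.map π (F₀.subst z) ≠ 0 := by
    intro h0
    have h1 := congrArg constantCoeff h0
    rw [hFz', Kernel.constantCoeff_subst_of_constantCoeff_eq_zero hzb0, ← coeff_zero_eq_constantCoeff_apply,
      coeff_map, coeff_zero_eq_constantCoeff_apply,
      ExpSide.constantCoeff_eq_one_of_map (algebraMap (WittVector 2 k) (FractionRing (WittVector 2 k)))
        (IsFractionRing.injective _ _) _ (map_compFn_eq_expLog k W a hαn hroot hH),
      map_one, map_zero] at h1
    exact one_ne_zero h1
  have hF2ne : PowerSeries.map π (F₀.subst z) ^ 2 ≠ 0 := pow_ne_zero 2 hFzne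
  apply mul_right_cancel₀ hF2ne
  rw [TK, CR]
  ring

end Summit.BirchSwinnertonDyer.BirchSwinnertonDyer.Theorems.DepletionAtTwo.KEta.TheoremKWitt

/-! ### Instance-free packaging (the `ℚ`-algebra structure on `Frac 𝕎(k)` is supplied, not assumed) -/

namespace Summit.BirchSwinnertonDyer.BirchSwinnertonDyer.Theorems.DepletionAtTwo.KEta.TheoremKWitt

open PowerSeries Literature.RingTheory.FormalGroups

/-- **THEOREM K, EXPLICIT FORM — final packaging.** `theoremK_explicit` with the auxiliary
`[Algebra ℚ (Frac 𝕎(k))]` instance discharged (`Frac 𝕎(k)` has characteristic `0`,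
`WittExistence.charZero_fractionRing`).  Hypotheses: an algebraically closed field `k` of
characteristic `2`; `W/ℤ`; `a ∈ ℤ` with the `2`-adic Honda type `hH`; a unit root `α ∈ ℤ₂` of
`X² − aX + 2`; an integral `2`-torsion `x`-coordinate `x₀ ∈ 𝕎(k)`; `ā₁ = 1`. -/
theorem theoremK_explicit' (k : Type*) [Field k] [IsAlgClosed k] [CharP k 2]
    (W : WeierstrassCurve ℤ) (a : ℤ) {α : ℤ_[2]} (hαn : ‖α‖ = 1)
    (hroot : (α : ℚ_[2]) ^ 2 - a * α + 2 = 0)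
    (hH : ∀ n, ‖coeff n (hondaShift 2 (a : ℚ_[2]) (W.map (Int.castRingHom ℚ_[2])).formalLog)‖ ≤ 1)
    {x₀ : WittVector 2 k}
    (hx : 4 * x₀ ^ 3 + (W.map (Int.castRingHom (WittVector 2 k))).b₂ * x₀ ^ 2 +
      2 * (W.map (Int.castRingHom (WittVector 2 k))).b₄ * x₀ +
        (W.map (Int.castRingHom (WittVector 2 k))).b₆ = 0)
    (ha1 : WittVector.constantCoeff (W.map (Int.castRingHom (WittVector 2 k))).a₁ = 1) :
    ∃ sbar : PowerSeries k, constantCoeff sbar = 0 ∧ sbar - sbar ^ 2 = lamBar k W a hαn hroot hH ∧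
      ∀ (z dz δgz : PowerSeries (WittVector 2 k)), constantCoeff z = 0 →
        Kernel.phi (WittVector.frobenius : WittVector 2 k →+* WittVector 2 k) z = z ^ 2 + 2 * dz →
        Kernel.phi (WittVector.frobenius : WittVector 2 k →+* WittVector 2 k)
            (((W.map (Int.castRingHom (WittVector 2 k))).formalXMulSq - C x₀ * X ^ 2).subst z) =
          (((W.map (Int.castRingHom (WittVector 2 k))).formalXMulSq - C x₀ * X ^ 2).subst z) ^ 2 +
            2 * δgz →
        PowerSeries.map (WittVector.constantCoeff : WittVector 2 k →+* k) δgz =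
          (PowerSeries.map (WittVector.constantCoeff : WittVector 2 k →+* k)
              (((W.map (Int.castRingHom (WittVector 2 k))).formalXMulSq - C x₀ * X ^ 2).subst z)) ^ 2 *
            (sbar.subst (PowerSeries.map (WittVector.constantCoeff : WittVector 2 k →+* k) z) +
              ((PowerSeries.map (WittVector.constantCoeff : WittVector 2 k →+* k)
                  (W.map (Int.castRingHom (WittVector 2 k))).formalInvDiff).subst
                (PowerSeries.map (WittVector.constantCoeff : WittVector 2 k →+* k) z)) ^ 2 *
              PowerSeries.map (WittVector.constantCoeff : WittVector 2 k →+* k) dz) := by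
  haveI : CharZero (FractionRing (WittVector 2 k)) := WittExistence.charZero_fractionRing k
  exact theoremK_explicit k W a hαn hroot hH hx ha1

end Summit.BirchSwinnertonDyer.BirchSwinnertonDyer.Theorems.DepletionAtTwo.KEta.TheoremKWitt

end
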